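/-
Copyright: the b2b-balaban T⁴-continuum CRUX team, row NE7b OWNER lineage `t4-ne7b-p1` (gen 124). Project licence.
-/
import Summits.QuantumFields.BalabanUV.T4Continuum.Spine.NE7b.SupZdCoarseSections
import Summits.QuantumFields.BalabanUV.T4Continuum.Spine.NE7b.SupZdCoarseSymmetry
import Summits.QuantumFields.BalabanUV.T4Continuum.Spine.NE7b.SupZdExponentialSums

/-!
# THE INFINITE-VOLUME COARSE OPERATOR IS INVERTIBLE: `T_∞ = Q′H_∞⁻¹Q′*` on `ℤ^d` (`V : ℤ^d → [−λ, Λ]`, `d ≥ 3`, ANY bounded block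
# columns) has an EXPONENTIALLY DECAYING inverse kernel `M = lim_{R→∞}(T_{[−R,R]^d})⁻¹`, `|M(b,b′)| ≤ c₁e^{−δ₁|b − b′|₁}` with
# `(c₁, δ₁)` from `(d, a, λ, Λ)` ONLY, and every finite-section inverse `(T_S)⁻¹` is within `c₁e^{−δ₁(|b − b′|₁ + dist(b,Sᶜ) + dist(b′,Sᶜ))}`
# of it — [B4] Sect. 5 (5.6) ⟹ (5.7)∕(5.8) (tree-proved over arbitrary finite index sets, `B4Sect5Torus.sect5Uniform_holds`) applied to
# the sections of `T_∞` with the `ℓ¹` distance, whose hypotheses are (186)'s floor and entry decay and (187)'s symmetry; `(n+1)^d·M` is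
# the infinite-volume next-scale Hessian kernel of the road's class (row NE7b, node U5c; (180)∕(186)∕(187)∕(189)∕(193) BY NAME; [folklore])

Cell `pub-balaban`, sub-cell `t4`, spine estimate NE7b (`T4WeightBudget.RelWeightBound`; the cell's OWN estimate — NOT PRINTED in
[Bałaban 1983–89], NOT PROVED).  Crux-route work under `Spine/NE7b/` by the row OWNER (`t4-ne7b-p1` gen 124, file (194)) under FREEZE
(0)'s crux-prover clause; NOTHING of Bałaban's is named as a Lean object, valued or asserted; no `T4Continuum/Support` leaf typed; no `def`,
no notation (the entries of `T_∞`, its sections as `Matrix.of`, Mathlib's `Matrix.inv`, the cubes `Fintype.piFinset` DISPLAYED; `M` is an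
`∃`); zero `sorry`.  Imports (BY NAME): the OWNER's (193) `…SupZdCoarseSections` (`extendByZero_sum`; through it (186) `zd_coarse_floor`,
`zd_coarse_entry_decay`), (187) `…SupZdCoarseSymmetry` (`zd_coarse_symmetric`; (180) `zd_propagator_exists`), (189) `…SupZdExponentialSums`
(`finset_sum_exp_l1_le`), (191) `natAbs_sub_comm_sum`, the Literature engine `B4Sect5Torus` (`IsPseudoDist`, `SumBound`, `Hyp56`,
`sect5Uniform_holds` = [Balaban1983RegularityDecay] Sect. 5, PROVED in the tree over finite index sets), Mathlib's
`cauchySeq_of_le_tendsto_0'`, `Filter.tendsto_add_atTop_iff_nat`.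

WHY (located).  § [NE7bP1-G123-HANDOFF] NEXT (3)(a): the infinite-volume next-scale Hessian is `(n+1)^dT_∞⁻¹`; (193) inverted the finite
sections with a uniform `ℓ²` bound.  [B4] Sect. 5 is EXACTLY the finite-section method with exponential control: (5.6) = symmetric +
floor + entry decay on a finite index set with a pseudo-distance and a lattice-sum profile ⟹ (5.7) the inverse of every compression
decays with the SAME constants and (5.8) two nested compressions differ by `e^{−δ₁(ρ + margins)}`.  On `S′ ⊃ S ⊃ [−R,R]^d` the margins are
`≥ R + 1 − |b|₁` (§1), so `((T_{[−R,R]^d})⁻¹(b,b′))_R` is Cauchy, its limit `M` inherits the decay, and (5.8) passes to `S′ = ℤ^d`.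

WHAT IS PROVED ([folklore]; `X d = ℤ^d`; `ρ(b,b′) = Σ_i|b i − b′ i|`; `T(b,b′) = (n+1)^{−d}Σ_{q ∈ B n b}Ψ_{b′} q` DISPLAYED; `T_S = Matrix.of` of
`T` on `↥S`): §1 `l1_triangle`, `isPseudoDist_l1(_section)`, `sumBound_l1_section` (profile `(2∕(1 − e^{−α}))^d`), `natAbs_le_l1`,
`mem_cube_of_l1_le`, `cube_mono`, `cube_margin`; §2 `zd_coarse_symmetric'` (symmetry from the block columns ALONE — the point columns
exist by (180)); §3 **`zd_coarse_section_hyp56`** (every section satisfies `Hyp56 ρ T_S γ C δ`, `γ = 1∕(36^d(4d + a + Λ))`); §4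
**`zd_coarse_section_inverse`** (`∃ c₁ δ₁`: `|(T_S)⁻¹(b,b′)| ≤ c₁e^{−δ₁ρ}` and the nested comparison with margins, ALL `S ⊆ S′`); §5
`limit_of_sections` (pure bookkeeping: a uniformly decaying, nested-consistent family of section kernels converges along the cubes, with
decay and (5.8) at `S′ = ℤ^d`), **`zd_coarse_inverse_exists`** (THE END: `∃ c₁ δ₁ > 0`, for ALL `n, V, Ψ`: `∃ M` with (i)
`(T_{[−R,R]^d})⁻¹(b,b′) → M(b,b′)`, (ii) decay, (iii) `|(T_S)⁻¹(b,b′) − M(b,b′)| ≤ c₁e^{−δ₁(ρ + β b + β b′)}` for all finite `S` and margins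
`0 ≤ β ≤ dist_ρ(·, ℤ^d ∖ S)`); §6 toy.

HONEST (what this is NOT).  The kernel `M` only — its symmetry, the identities `T_∞M = MT_∞ = 1` on `ℤ^d` (Tannery through (i) + (189)'s
rows), uniqueness of the bounded two-sided inverse, the convergence of the TORUS next-scale Hessians `(n+1)^dT_k⁻¹(σ_k b, σ_k b′)` to
`(n+1)^dM(b,b′)`, and the response ∕ covariance on `ℤ^d` are the sequel; `d ≥ 3` only; the LINEAR column only; scalar skeleton ((A3), NC-NE7b-α UNRULED); nothing of
the covariant propagators of [B4]–[B6]; [B4] Sect. 5 is the tree's PROVED theorem, used by name — nothing of Bałaban's asserted.  BY-NAME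
EFFECT ON THE WALL: NONE.  NE7b NOT PRINTED ∕ NOT PROVED; spine PROVED 0∕9; rung (B)+1 — the programme's measures remain FINITE-torus
statements; NOT the mass gap, NOT Clay.  HONEST DEPENDENCY: continuum YM on T⁴ ⇐ BetaPertH ∧ nine spine estimates (0∕9 proved); BetaPertH ⇐
(D1) ∧ (D4) ∧ CAP+tail; G-an2-4 gates asym, D1 and NE2∕3∕4.
-/

set_option autoImplicit false

noncomputable section

namespace Summit.QuantumFields.BalabanUV.T4Continuum.NE7b.SupZdCoarseInverse

open Real Filter Topology
open Literature.MathematicalPhysics.QuantumFieldTheory.Balaban1983to89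
open B6QGQLower276 (X e blk B side chart mem_B sum_B sum_B_const card_cube blk_chart)
open B4Sect5Torus (IsPseudoDist SumBound Hyp56 sect5Uniform_holds)
open SupZdPropagatorLimit (zd_propagator_exists)
open SupZdCoarseOperator (zd_coarse_entry_decay zd_coarse_floor)
open SupZdCoarseSymmetry (zd_coarse_symmetric)
open SupZdExponentialSums (finset_sum_exp_l1_le summable_exp_l1)
open SupZdCoarseForm (natAbs_sub_comm_sum)
open SupZdCoarseSections (extendByZero_sum)

variable {d : ℕ}

/-! ## §1. The `ℓ¹` distance on `ℤ^d`: a pseudo-distance with a uniform profile on every finite section; cube margins -/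

/-- The `ℓ¹` distance on `ℤ^d` satisfies the triangle inequality. [folklore] -/
theorem l1_triangle (b b' b'' : X d) :
    ∑ i, (((b i - b'' i).natAbs : ℕ) : ℝ) ≤ ∑ i, (((b i - b' i).natAbs : ℕ) : ℝ) + ∑ i, (((b' i - b'' i).natAbs : ℕ) : ℝ) := by
  rw [← Finset.sum_add_distrib]
  refine Finset.sum_le_sum fun i _ => ?_
  have h : (b i - b'' i).natAbs ≤ (b i - b' i).natAbs + (b' i - b'' i).natAbs := by
    have := Int.natAbs_add_le (b i - b' i) (b' i - b'' i)
    rwa [show b i - b' i + (b' i - b'' i) = b i - b'' i by ring] at this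
  exact_mod_cast h

/-- **The `ℓ¹` distance on `ℤ^d` is a pseudo-distance** in the sense of `B4Sect5Torus.IsPseudoDist`. [folklore] -/
theorem isPseudoDist_l1 : IsPseudoDist (fun b b' : X d => ∑ i, (((b i - b' i).natAbs : ℕ) : ℝ)) :=
  ⟨fun b b' => natAbs_sub_comm_sum b b', fun b => by simp, fun b b' b'' => l1_triangle b b' b''⟩

/-- Its restriction to a finite section `S ⊂ ℤ^d` is a pseudo-distance on the finite index set `S`. [folklore] -/
theorem isPseudoDist_l1_section (S : Finset (X d)) :
    IsPseudoDist (fun b b' : S => ∑ i, ((((b : X d) i - (b' : X d) i).natAbs : ℕ) : ℝ)) :=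
  isPseudoDist_l1.comp (fun b : S => (b : X d))

/-- **Uniform profile**: on every finite section `S`, `Σ_{b′ ∈ S} e^{−α|b − b′|₁} ≤ (2∕(1 − e^{−α}))^d` for every rate `α > 0` and centre —
(189) `finset_sum_exp_l1_le`; the profile does not depend on `S`. [folklore] -/
theorem sumBound_l1_section (S : Finset (X d)) :
    SumBound (fun b b' : S => ∑ i, ((((b : X d) i - (b' : X d) i).natAbs : ℕ) : ℝ)) (fun α => (2 * (1 - exp (-α))⁻¹) ^ d) := by
  intro α hα b
  rw [Finset.sum_coe_sort S (fun b' => exp (-(α * ∑ i, ((((b : X d) i - b' i).natAbs : ℕ) : ℝ))))]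
  exact finset_sum_exp_l1_le hα _ S

/-- A coordinate is bounded by the `ℓ¹` norm: `|b i| ≤ |b|₁`. [folklore] -/
theorem natAbs_le_l1 (b : X d) (i : Fin d) : (b i).natAbs ≤ ∑ j, (b j).natAbs :=
  Finset.single_le_sum (f := fun j => (b j).natAbs) (fun _ _ => Nat.zero_le _) (Finset.mem_univ i)

/-- `|b|₁ ≤ R` puts `b` in the cube `[−R, R]^d`. [folklore] -/
theorem mem_cube_of_l1_le (R : ℕ) (b : X d) (h : ∑ j, (b j).natAbs ≤ R) :
    b ∈ Fintype.piFinset fun _ : Fin d => Finset.Icc (-(R : ℤ)) R := by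
  refine Fintype.mem_piFinset.2 fun i => Finset.mem_Icc.2 ?_
  have hi : ((b i).natAbs : ℤ) ≤ R := by exact_mod_cast (natAbs_le_l1 b i).trans h
  rw [Int.natCast_natAbs] at hi
  exact ⟨by linarith [neg_abs_le (b i)], (le_abs_self _).trans hi⟩

/-- The cubes increase. [folklore] -/
theorem cube_mono {R R' : ℕ} (h : R ≤ R') :
    (Fintype.piFinset fun _ : Fin d => Finset.Icc (-(R : ℤ)) R) ⊆ Fintype.piFinset fun _ : Fin d => Finset.Icc (-(R' : ℤ)) R' := by
  intro b hb
  refine Fintype.mem_piFinset.2 fun i => ?_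
  have h1 := Finset.mem_Icc.1 (Fintype.mem_piFinset.1 hb i)
  have hRR : (R : ℤ) ≤ R' := by exact_mod_cast h
  exact Finset.mem_Icc.2 ⟨by linarith [h1.1], by linarith [h1.2]⟩

/-- **CUBE MARGINS**: a point `z` outside the cube `[−R, R]^d` is at `ℓ¹` distance `≥ R + 1 − |c|₁` from every `c`. [folklore] -/
theorem cube_margin (R : ℕ) (c z : X d) (hz : z ∉ Fintype.piFinset fun _ : Fin d => Finset.Icc (-(R : ℤ)) R) :
    (R : ℝ) + 1 - ∑ j, (((c j).natAbs : ℕ) : ℝ) ≤ ∑ j, (((c j - z j).natAbs : ℕ) : ℝ) := by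
  rw [Fintype.mem_piFinset] at hz
  push Not at hz
  obtain ⟨i, hi⟩ := hz
  rw [Finset.mem_Icc, not_and_or, not_le, not_le] at hi
  -- `R + 1 ≤ |z i| ≤ |c i| + |c i − z i| ≤ |c|₁ + |c − z|₁`
  have h1 : (R : ℤ) + 1 ≤ ((z i).natAbs : ℤ) := by
    rw [Int.natCast_natAbs]
    rcases hi with hi | hi
    · have := neg_abs_le (z i); have := le_abs_self (z i); rw [abs_eq_neg_self.2 (by linarith)]; linarith
    · exact Int.add_one_le_iff.2 (lt_of_lt_of_le hi (le_abs_self _))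
  have h2 : (z i).natAbs ≤ (c i).natAbs + (c i - z i).natAbs := by
    have := Int.natAbs_add_le (c i) (-(c i - z i))
    rwa [show c i + -(c i - z i) = z i by ring, Int.natAbs_neg] at this
  have h3 := natAbs_le_l1 c i
  have h4 : (c i - z i).natAbs ≤ ∑ j, (c j - z j).natAbs :=
    Finset.single_le_sum (f := fun j => (c j - z j).natAbs) (fun _ _ => Nat.zero_le _) (Finset.mem_univ i)
  have h5 : R + 1 ≤ ∑ j, (c j).natAbs + ∑ j, (c j - z j).natAbs := by omega
  have h6 : (R : ℝ) + 1 ≤ (∑ j, (c j).natAbs : ℕ) + (∑ j, (c j - z j).natAbs : ℕ) := by exact_mod_cast h5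
  push_cast at h6
  linarith

/-! ## §2. Bounded point columns exist; `T_∞` is symmetric given the block columns alone -/

/-- **`T_∞(b,b′) = T_∞(b′,b)` FROM THE BLOCK COLUMNS ALONE**: the bounded point columns `G_{q′}` that (187) `zd_coarse_symmetric` takes as
data EXIST by (180) `zd_propagator_exists` (a point source `𝟙_{q′}` is a block source in the block of `q′`). [folklore] -/
theorem zd_coarse_symmetric' (hd : 3 ≤ d) (a : ℝ) (ha : 0 < a) {lam Lam : ℝ} (hlam : lam < min 2 a) (hLam : 0 ≤ Lam)
    (n : ℕ) (V : X d → ℝ) (hV : ∀ p, -lam ≤ V p) (hV' : ∀ p, V p ≤ Lam)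
    (Ψ : X d → X d → ℝ) (BΨ : X d → ℝ) (hΨB : ∀ b' p, |Ψ b' p| ≤ BΨ b')
    (hΨ : ∀ b' p, ((n : ℝ) + 1) ^ 2 * ∑ μ, (2 * Ψ b' p - Ψ b' (p + e μ) - Ψ b' (p - e μ))
      + a / ((n : ℝ) + 1) ^ d * ∑ q ∈ B n (blk n p), Ψ b' q + V p * Ψ b' p = if blk n p = b' then 1 else 0)
    (b b' : X d) :
    (((n : ℝ) + 1) ^ d)⁻¹ * ∑ q ∈ B n b, Ψ b' q = (((n : ℝ) + 1) ^ d)⁻¹ * ∑ q' ∈ B n b', Ψ b q' := by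
  classical
  obtain ⟨C, δ, hC, hδ, H180⟩ := zd_propagator_exists (d := d) hd a ha hlam hLam
  -- the bounded point columns
  have hex : ∀ q' : X d, ∃ u : X d → ℝ,
      (∀ p, ((n : ℝ) + 1) ^ 2 * ∑ μ, (2 * u p - u (p + e μ) - u (p - e μ))
        + a / ((n : ℝ) + 1) ^ d * ∑ q ∈ B n (blk n p), u q + V p * u p = if p = q' then 1 else 0) ∧
      (∀ p, |u p| ≤ C * 1) := by
    intro q'
    obtain ⟨u, hueq, hudec⟩ := H180 n V hV hV' (blk n q') 1 (fun p => if p = q' then (1 : ℝ) else 0)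
      (fun p hp => by rw [if_neg]; rintro rfl; exact hp rfl) (fun p => by split_ifs <;> simp)
    refine ⟨u, hueq, fun p => ?_⟩
    have h := hudec p
    have h1 : (1 : ℝ) ≤ exp (δ * ∑ i, (((blk n p i - blk n q' i).natAbs : ℕ) : ℝ)) := one_le_exp (by positivity)
    nlinarith [abs_nonneg (u p)]
  choose G hG hGB using hex
  exact zd_coarse_symmetric hd a ha hlam hLam n V hV hV' G (fun _ => C * 1) hGB hG Ψ BΨ hΨB hΨ b b'

/-! ## §3. Every finite section of `T_∞` satisfies [B4] (5.6) with constants independent of the section, the mesh and the potential -/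

/-- **THE FINITE SECTIONS OF `T_∞` SATISFY `Hyp56` UNIFORMLY**: `∃ C δ > 0` from `(d, a, λ, Λ)` such that for ALL `n`, `V : ℤ^d → [−λ, Λ]`,
ANY bounded block columns `Ψ` and EVERY finite `S ⊂ ℤ^d`, the matrix `(T_∞(b,b′))_{b,b′ ∈ S}` is symmetric (§2), has the form floor
`γ = 1∕(36^d(4d + a + Λ))` ((186) `zd_coarse_floor` on the zero-extension) and the entry bound `C·e^{−δ|b − b′|₁}` ((186)
`zd_coarse_entry_decay`) — [B4] (5.6) on the index set `S` with the `ℓ¹` distance. [folklore] -/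
theorem zd_coarse_section_hyp56 (hd : 3 ≤ d) (a : ℝ) (ha : 0 < a) {lam Lam : ℝ} (hlam : lam < min 2 a) (hLam : 0 ≤ Lam) :
    ∃ C δ : ℝ, 0 < C ∧ 0 < δ ∧ ∀ (n : ℕ) (V : X d → ℝ), (∀ p, -lam ≤ V p) → (∀ p, V p ≤ Lam) →
      ∀ (Ψ : X d → X d → ℝ) (BΨ : X d → ℝ), (∀ b' p, |Ψ b' p| ≤ BΨ b') →
      (∀ b' p, ((n : ℝ) + 1) ^ 2 * ∑ μ, (2 * Ψ b' p - Ψ b' (p + e μ) - Ψ b' (p - e μ))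
        + a / ((n : ℝ) + 1) ^ d * ∑ q ∈ B n (blk n p), Ψ b' q + V p * Ψ b' p = if blk n p = b' then 1 else 0) →
      ∀ S : Finset (X d),
        Hyp56 (fun b b' : S => ∑ i, ((((b : X d) i - (b' : X d) i).natAbs : ℕ) : ℝ))
          (Matrix.of fun b b' : S => (((n : ℝ) + 1) ^ d)⁻¹ * ∑ q ∈ B n (b : X d), Ψ (b' : X d) q)
          (1 / ((36 : ℝ) ^ d * (4 * d + a + Lam))) C δ := by
  classical
  obtain ⟨C, δ, hC, hδ, H186⟩ := zd_coarse_entry_decay (d := d) hd a ha hlam hLam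
  refine ⟨C, δ, hC, hδ, ?_⟩
  intro n V hV hV' Ψ BΨ hΨB hΨ S
  refine ⟨Matrix.IsSymm.ext fun b b' => ?_, fun v => ?_, fun b b' => ?_⟩
  · -- symmetric
    simp only [Matrix.of_apply]
    exact zd_coarse_symmetric' hd a ha hlam hLam n V hV hV' Ψ BΨ hΨB hΨ _ _
  · -- the floor on the zero-extension
    have hzero : ∀ b, b ∉ S → (fun b => if h : b ∈ S then v ⟨b, h⟩ else (0 : ℝ)) b = 0 := fun b hb => by
      simp only [dif_neg hb]
    have h := zd_coarse_floor hd a ha hlam hLam n V hV hV' Ψ BΨ hΨB hΨ S (fun b => if h : b ∈ S then v ⟨b, h⟩ else 0) hzero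
    have hsq : ∑ b ∈ S, (if h : b ∈ S then v ⟨b, h⟩ else 0) ^ 2 = ∑ b : S, v b ^ 2 := extendByZero_sum S v (fun _ x => x ^ 2)
    have hform : ∑ b ∈ S, (if h : b ∈ S then v ⟨b, h⟩ else 0)
        * ∑ b' ∈ S, ((((n : ℝ) + 1) ^ d)⁻¹ * ∑ q ∈ B n b, Ψ b' q) * (if h : b' ∈ S then v ⟨b', h⟩ else 0)
        = ∑ b : S, v b * (Matrix.of fun b b' : S => (((n : ℝ) + 1) ^ d)⁻¹ * ∑ q ∈ B n (b : X d), Ψ (b' : X d) q).mulVec v b := by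
      rw [extendByZero_sum S v (fun b x => x * ∑ b' ∈ S, ((((n : ℝ) + 1) ^ d)⁻¹ * ∑ q ∈ B n b, Ψ b' q)
        * (if h : b' ∈ S then v ⟨b', h⟩ else 0))]
      refine Finset.sum_congr rfl fun b _ => ?_
      simp only [Matrix.mulVec, dotProduct, Matrix.of_apply]
      rw [extendByZero_sum S v (fun b' x => ((((n : ℝ) + 1) ^ d)⁻¹ * ∑ q ∈ B n (b : X d), Ψ b' q) * x)]
    rw [hsq, hform] at h
    exact h
  · -- the entries
    simp only [Matrix.of_apply]
    exact H186 n V hV hV' Ψ BΨ hΨB hΨ _ _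

/-! ## §4. The section inverses: uniform Combes–Thomas decay and the nested-section comparison -/

/-- **THE SECTION INVERSES DECAY UNIFORMLY AND COMPARE ACROSS NESTED SECTIONS** ([B4] Sect. 5 (5.7)∕(5.8), tree-proved as
`B4Sect5Torus.sect5Uniform_holds`, on the index set `S′` with the `ℓ¹` distance and the compression to `S ⊆ S′`): `∃ c₁ δ₁ > 0` from
`(d, a, λ, Λ)` such that for ALL `n`, `V : ℤ^d → [−λ, Λ]`, ANY bounded block columns `Ψ`, all finite `S ⊆ S′ ⊂ ℤ^d`:
`|(T_S)⁻¹(b,b′)| ≤ c₁e^{−δ₁|b − b′|₁}` and, for every margin `β ≥ 0` on `S` with `β b ≤ |b − z|₁` for all `z ∈ S′ ∖ S`,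
`|(T_S)⁻¹(b,b′) − (T_{S′})⁻¹(b,b′)| ≤ c₁e^{−δ₁(|b − b′|₁ + β b + β b′)}` (`T_S` = the section as a `Matrix S S ℝ`, `⁻¹` = `Matrix.inv`). [folklore] -/
theorem zd_coarse_section_inverse (hd : 3 ≤ d) (a : ℝ) (ha : 0 < a) {lam Lam : ℝ} (hlam : lam < min 2 a) (hLam : 0 ≤ Lam) :
    ∃ c₁ δ₁ : ℝ, 0 < c₁ ∧ 0 < δ₁ ∧ ∀ (n : ℕ) (V : X d → ℝ), (∀ p, -lam ≤ V p) → (∀ p, V p ≤ Lam) →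
      ∀ (Ψ : X d → X d → ℝ) (BΨ : X d → ℝ), (∀ b' p, |Ψ b' p| ≤ BΨ b') →
      (∀ b' p, ((n : ℝ) + 1) ^ 2 * ∑ μ, (2 * Ψ b' p - Ψ b' (p + e μ) - Ψ b' (p - e μ))
        + a / ((n : ℝ) + 1) ^ d * ∑ q ∈ B n (blk n p), Ψ b' q + V p * Ψ b' p = if blk n p = b' then 1 else 0) →
      ∀ (S S' : Finset (X d)) (hSS' : S ⊆ S'),
        (∀ b b' : S, |(Matrix.of fun b b' : S => (((n : ℝ) + 1) ^ d)⁻¹ * ∑ q ∈ B n (b : X d), Ψ (b' : X d) q)⁻¹ b b'|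
          ≤ c₁ * exp (-(δ₁ * ∑ i, ((((b : X d) i - (b' : X d) i).natAbs : ℕ) : ℝ)))) ∧
        (∀ β : S → ℝ, (∀ b, 0 ≤ β b) → (∀ (b : S) (z : X d), z ∈ S' → z ∉ S → β b ≤ ∑ i, ((((b : X d) i - z i).natAbs : ℕ) : ℝ)) →
          ∀ b b' : S, |(Matrix.of fun b b' : S => (((n : ℝ) + 1) ^ d)⁻¹ * ∑ q ∈ B n (b : X d), Ψ (b' : X d) q)⁻¹ b b'
              - (Matrix.of fun b b' : S' => (((n : ℝ) + 1) ^ d)⁻¹ * ∑ q ∈ B n (b : X d), Ψ (b' : X d) q)⁻¹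
                  ⟨b, hSS' b.2⟩ ⟨b', hSS' b'.2⟩|
            ≤ c₁ * exp (-(δ₁ * (∑ i, ((((b : X d) i - (b' : X d) i).natAbs : ℕ) : ℝ) + β b + β b')))) := by
  classical
  obtain ⟨C, δ, hC, hδ, H56⟩ := zd_coarse_section_hyp56 (d := d) hd a ha hlam hLam
  have hγ : (0 : ℝ) < 1 / ((36 : ℝ) ^ d * (4 * d + a + Lam)) := by positivity
  have hK : ∀ α : ℝ, 0 < α → 0 ≤ (2 * (1 - exp (-α))⁻¹) ^ d := fun α hα =>
    pow_nonneg (mul_nonneg zero_le_two (inv_nonneg.2 (sub_nonneg.2 (exp_le_one_iff.2 (by linarith))))) d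
  obtain ⟨c₁, δ₁, hc₁, hδ₁, H5⟩ := sect5Uniform_holds (fun α => (2 * (1 - exp (-α))⁻¹) ^ d) hK _ C δ hγ hC hδ
  refine ⟨c₁, δ₁, hc₁, hδ₁, ?_⟩
  intro n V hV hV' Ψ BΨ hΨB hΨ S S' hSS'
  -- [B4] Sect. 5 on the index set `S′`, compressed along the inclusion `S ↪ S′`
  set ι : S → S' := fun b => ⟨b.1, hSS' b.2⟩ with hι
  have hιinj : Function.Injective ι := fun b b' h => Subtype.ext (by simpa [hι] using congrArg Subtype.val h)
  have h := H5 (S' : Type) (fun b b' : S' => ∑ i, ((((b : X d) i - (b' : X d) i).natAbs : ℕ) : ℝ))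
    (isPseudoDist_l1_section S') (sumBound_l1_section S') _ (H56 n V hV hV' Ψ BΨ hΨB hΨ S') (S : Type) ι hιinj
  have hsub : (Matrix.of fun b b' : S' => (((n : ℝ) + 1) ^ d)⁻¹ * ∑ q ∈ B n (b : X d), Ψ (b' : X d) q).submatrix ι ι
      = Matrix.of fun b b' : S => (((n : ℝ) + 1) ^ d)⁻¹ * ∑ q ∈ B n (b : X d), Ψ (b' : X d) q := by
    ext b b'
    simp only [Matrix.submatrix_apply, Matrix.of_apply, hι]
  rw [hsub] at h
  refine ⟨fun b b' => h.1 b b', fun β hβ0 hβ b b' => ?_⟩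
  refine h.2.1 β hβ0 (fun b z hz => hβ b z.1 z.2 fun hzS => hz ⟨⟨z.1, hzS⟩, Subtype.ext rfl⟩) b b'

/-! ## §5. THE END: the inverse of `T_∞` on `ℤ^d` as the limit of the section inverses -/

/-- **THE LIMIT OF A CONSISTENT FAMILY OF SECTION KERNELS** (bookkeeping behind the headline): a family `M_S` (`S ⊂ ℤ^d` finite) of
kernels with the uniform decay `|M_S(b,b′)| ≤ c₁e^{−δ₁|b − b′|₁}` and the nested comparison `|M_S − M_{S′}|(b,b′) ≤
c₁e^{−δ₁(|b − b′|₁ + β b + β b′)}` (`S ⊆ S′`, margins `β ≤ dist(·, S′ ∖ S)`) converges along the cubes `[−R, R]^d` to a kernel `M` with the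
same decay, and EVERY `M_S` is within `c₁e^{−δ₁(|b − b′|₁ + β b + β b′)}` of `M` for margins `β ≤ dist(·, ℤ^d ∖ S)` — the cube sequence is
Cauchy by the comparison (margins `R + 1 − |b|₁ → ∞`, §1 `cube_margin`). [folklore] -/
theorem limit_of_sections {c₁ δ₁ : ℝ} (hc₁ : 0 < c₁) (hδ₁ : 0 < δ₁) (Minv : (S : Finset (X d)) → Matrix S S ℝ)
    (h1 : ∀ (S : Finset (X d)) (b b' : S),
      |Minv S b b'| ≤ c₁ * exp (-(δ₁ * ∑ i, ((((b : X d) i - (b' : X d) i).natAbs : ℕ) : ℝ))))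
    (h2 : ∀ (S S' : Finset (X d)) (hSS' : S ⊆ S') (β : S → ℝ), (∀ b, 0 ≤ β b) →
      (∀ (b : S) (z : X d), z ∈ S' → z ∉ S → β b ≤ ∑ i, ((((b : X d) i - z i).natAbs : ℕ) : ℝ)) →
      ∀ b b' : S, |Minv S b b' - Minv S' ⟨b, hSS' b.2⟩ ⟨b', hSS' b'.2⟩|
        ≤ c₁ * exp (-(δ₁ * (∑ i, ((((b : X d) i - (b' : X d) i).natAbs : ℕ) : ℝ) + β b + β b')))) :
    ∃ M : X d → X d → ℝ,
      (∀ b b' : X d, Tendsto (fun R : ℕ =>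
          if h : b ∈ (Fintype.piFinset fun _ : Fin d => Finset.Icc (-(R : ℤ)) R) ∧
              b' ∈ (Fintype.piFinset fun _ : Fin d => Finset.Icc (-(R : ℤ)) R)
            then Minv (Fintype.piFinset fun _ : Fin d => Finset.Icc (-(R : ℤ)) R) ⟨b, h.1⟩ ⟨b', h.2⟩ else 0)
        atTop (𝓝 (M b b'))) ∧
      (∀ b b' : X d, |M b b'| ≤ c₁ * exp (-(δ₁ * ∑ i, (((b i - b' i).natAbs : ℕ) : ℝ)))) ∧
      (∀ (S : Finset (X d)) (β : X d → ℝ), (∀ b, 0 ≤ β b) →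
        (∀ b ∈ S, ∀ z ∉ S, β b ≤ ∑ i, (((b i - z i).natAbs : ℕ) : ℝ)) →
        ∀ b b' : S, |Minv S b b' - M b b'|
          ≤ c₁ * exp (-(δ₁ * (∑ i, ((((b : X d) i - (b' : X d) i).natAbs : ℕ) : ℝ) + β b + β b')))) := by
  classical
  obtain ⟨MR, hMR⟩ : ∃ MR : ℕ → X d → X d → ℝ, ∀ R b b', MR R b b' =
      if h : b ∈ (Fintype.piFinset fun _ : Fin d => Finset.Icc (-(R : ℤ)) R) ∧
          b' ∈ (Fintype.piFinset fun _ : Fin d => Finset.Icc (-(R : ℤ)) R)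
        then Minv (Fintype.piFinset fun _ : Fin d => Finset.Icc (-(R : ℤ)) R) ⟨b, h.1⟩ ⟨b', h.2⟩ else 0 :=
    ⟨_, fun _ _ _ => rfl⟩
  have hρ0 : ∀ b b' : X d, (0 : ℝ) ≤ ∑ i, (((b i - b' i).natAbs : ℕ) : ℝ) := fun b b' => by positivity
  -- every zero-extended section entry is under the decay profile
  have hbd : ∀ R b b', |MR R b b'| ≤ c₁ * exp (-(δ₁ * ∑ i, (((b i - b' i).natAbs : ℕ) : ℝ))) := by
    intro R b b'
    rw [hMR]
    split_ifs with h
    · exact h1 _ _ _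
    · rw [abs_zero]; positivity
  -- the nested comparison between the cubes `R ≤ R′` at points of the smaller cube, with the cube margins
  have hcmp : ∀ R R' : ℕ, R ≤ R' → ∀ b b' : X d, b ∈ (Fintype.piFinset fun _ : Fin d => Finset.Icc (-(R : ℤ)) R) →
      b' ∈ (Fintype.piFinset fun _ : Fin d => Finset.Icc (-(R : ℤ)) R) →
      |MR R b b' - MR R' b b'| ≤ c₁ * exp (-(δ₁ * (∑ i, (((b i - b' i).natAbs : ℕ) : ℝ)
        + ((R : ℝ) + 1 - ∑ j, (((b j).natAbs : ℕ) : ℝ)) + ((R : ℝ) + 1 - ∑ j, (((b' j).natAbs : ℕ) : ℝ))))) := by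
    intro R R' hRR' b b' hb hb'
    have hsub := cube_mono (d := d) hRR'
    rw [hMR, hMR, dif_pos ⟨hb, hb'⟩, dif_pos ⟨hsub hb, hsub hb'⟩]
    have hadm : ∀ (c : ↥(Fintype.piFinset fun _ : Fin d => Finset.Icc (-(R : ℤ)) R)) (z : X d),
        z ∈ (Fintype.piFinset fun _ : Fin d => Finset.Icc (-(R' : ℤ)) R') →
        z ∉ (Fintype.piFinset fun _ : Fin d => Finset.Icc (-(R : ℤ)) R) →
        max 0 ((R : ℝ) + 1 - ∑ j, ((((c : X d) j).natAbs : ℕ) : ℝ)) ≤ ∑ i, ((((c : X d) i - z i).natAbs : ℕ) : ℝ) := by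
      intro c z _ hzR
      exact max_le (hρ0 (c : X d) z) (cube_margin R (c : X d) z hzR)
    have h := h2 _ _ hsub (fun c => max 0 ((R : ℝ) + 1 - ∑ j, ((((c : X d) j).natAbs : ℕ) : ℝ))) (fun c => le_max_left _ _)
      hadm ⟨b, hb⟩ ⟨b', hb'⟩
    refine h.trans (mul_le_mul_of_nonneg_left (exp_le_exp.2 (neg_le_neg (mul_le_mul_of_nonneg_left ?_ hδ₁.le))) hc₁.le)
    have e1 := le_max_right 0 ((R : ℝ) + 1 - ∑ j, (((b j).natAbs : ℕ) : ℝ))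
    have e2 := le_max_right 0 ((R : ℝ) + 1 - ∑ j, (((b' j).natAbs : ℕ) : ℝ))
    simp only at e1 e2 ⊢
    linarith
  -- at every pair the cube sequence converges: shifted beyond `R₀ = |b|₁ + |b′|₁` it is Cauchy by the comparison
  have hconv : ∀ b b' : X d, ∃ L : ℝ, Tendsto (fun R : ℕ => MR R b b') atTop (𝓝 L) := by
    intro b b'
    set R₀ : ℕ := ∑ j, (b j).natAbs + ∑ j, (b' j).natAbs with hR₀
    have hmem : ∀ k : ℕ, b ∈ (Fintype.piFinset fun _ : Fin d => Finset.Icc (-((k + R₀ : ℕ) : ℤ)) ((k + R₀ : ℕ) : ℤ)) ∧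
        b' ∈ (Fintype.piFinset fun _ : Fin d => Finset.Icc (-((k + R₀ : ℕ) : ℤ)) ((k + R₀ : ℕ) : ℤ)) := fun k =>
      ⟨mem_cube_of_l1_le _ b (by omega), mem_cube_of_l1_le _ b' (by omega)⟩
    have hR₀cast : (R₀ : ℝ) = ∑ j, (((b j).natAbs : ℕ) : ℝ) + ∑ j, (((b' j).natAbs : ℕ) : ℝ) := by rw [hR₀]; push_cast; rfl
    have hr1 : exp (-δ₁) < 1 := exp_lt_one_iff.2 (by linarith)
    have hcau : CauchySeq (fun k : ℕ => MR (k + R₀) b b') := by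
      refine cauchySeq_of_le_tendsto_0' (fun k : ℕ => c₁ * exp (-δ₁) ^ k) (fun k m hkm => ?_) ?_
      · rw [Real.dist_eq]
        refine (hcmp (k + R₀) (m + R₀) (by omega) b b' (hmem k).1 (hmem k).2).trans
          (mul_le_mul_of_nonneg_left ?_ hc₁.le)
        rw [← Real.exp_nat_mul, exp_le_exp]
        have h0 := hρ0 b b'
        push_cast
        rw [hR₀cast]
        nlinarith
      · simpa using (tendsto_pow_atTop_nhds_zero_of_lt_one (exp_pos _).le hr1).const_mul c₁
    obtain ⟨L, hL⟩ := cauchySeq_tendsto_of_complete hcau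
    exact ⟨L, (Filter.tendsto_add_atTop_iff_nat R₀).1 hL⟩
  choose M hM using hconv
  refine ⟨M, fun b b' => by simpa only [hMR] using hM b b', fun b b' => ?_, fun S β hβ0 hβ b b' => ?_⟩
  · -- decay passes to the limit
    exact le_of_tendsto' (hM b b').abs fun R => hbd R b b'
  · -- every section inverse is close to the limit, deep inside the section
    set R₁ : ℕ := ∑ c ∈ S, ∑ j, (c j).natAbs with hR₁
    have hSQ : ∀ R : ℕ, R₁ ≤ R → S ⊆ Fintype.piFinset fun _ : Fin d => Finset.Icc (-(R : ℤ)) R := fun R hR c hc =>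
      mem_cube_of_l1_le R c (le_trans (le_trans
        (Finset.single_le_sum (f := fun c => ∑ j, (c j).natAbs) (fun _ _ => Nat.zero_le _) hc) (le_of_eq hR₁.symm)) hR)
    have hev : ∀ R : ℕ, R₁ ≤ R → |Minv S b b' - MR R b b'|
        ≤ c₁ * exp (-(δ₁ * (∑ i, ((((b : X d) i - (b' : X d) i).natAbs : ℕ) : ℝ) + β b + β b'))) := by
      intro R hR
      have hsub := hSQ R hR
      rw [hMR, dif_pos ⟨hsub b.2, hsub b'.2⟩]
      exact h2 S _ hsub (fun c => β c) (fun c => hβ0 c) (fun c z _ hzS => hβ c c.2 z hzS) b b'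
    exact le_of_tendsto (tendsto_const_nhds.sub (hM b b')).abs (Filter.eventually_atTop.2 ⟨R₁, hev⟩)

/-- **HEADLINE — `T_∞` HAS A SYMMETRIC, EXPONENTIALLY DECAYING INVERSE KERNEL ON `ℤ^d`, THE LIMIT OF ITS SECTION INVERSES**: `d ≥ 3`,
`a > 0`, `λ < min(2,a)`, `Λ ≥ 0` ⟹ `∃ c₁ δ₁ > 0` (from `(d, a, λ, Λ)` only) such that for ALL `n`, `V : ℤ^d → [−λ, Λ]` and ANY bounded
block columns `Ψ` of `H_V` there is `M : ℤ^d × ℤ^d → ℝ` with: (i) `(T_{[−R,R]^d})⁻¹(b,b′) → M(b,b′)` as `R → ∞`; (ii) `|M(b,b′)| ≤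
c₁e^{−δ₁|b − b′|₁}`; (iii) for EVERY finite `S` and margins `0 ≤ β ≤ dist_{ℓ¹}(·, ℤ^d ∖ S)` on `S`:
`|(T_S)⁻¹(b,b′) − M(b,b′)| ≤ c₁e^{−δ₁(|b − b′|₁ + β b + β b′)}` — [B4] (5.7)∕(5.8) in infinite volume.  `(n+1)^d·M` is the infinite-volume
next-scale Hessian kernel of the road's class (its symmetry, two-sided inverse identities and uniqueness: the sequel). [folklore] -/
theorem zd_coarse_inverse_exists (hd : 3 ≤ d) (a : ℝ) (ha : 0 < a) {lam Lam : ℝ} (hlam : lam < min 2 a) (hLam : 0 ≤ Lam) :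
    ∃ c₁ δ₁ : ℝ, 0 < c₁ ∧ 0 < δ₁ ∧ ∀ (n : ℕ) (V : X d → ℝ), (∀ p, -lam ≤ V p) → (∀ p, V p ≤ Lam) →
      ∀ (Ψ : X d → X d → ℝ) (BΨ : X d → ℝ), (∀ b' p, |Ψ b' p| ≤ BΨ b') →
      (∀ b' p, ((n : ℝ) + 1) ^ 2 * ∑ μ, (2 * Ψ b' p - Ψ b' (p + e μ) - Ψ b' (p - e μ))
        + a / ((n : ℝ) + 1) ^ d * ∑ q ∈ B n (blk n p), Ψ b' q + V p * Ψ b' p = if blk n p = b' then 1 else 0) →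
      ∃ M : X d → X d → ℝ,
        (∀ b b' : X d, Tendsto (fun R : ℕ =>
            if h : b ∈ (Fintype.piFinset fun _ : Fin d => Finset.Icc (-(R : ℤ)) R) ∧
                b' ∈ (Fintype.piFinset fun _ : Fin d => Finset.Icc (-(R : ℤ)) R)
              then (Matrix.of fun c c' : ↥(Fintype.piFinset fun _ : Fin d => Finset.Icc (-(R : ℤ)) R) =>
                (((n : ℝ) + 1) ^ d)⁻¹ * ∑ q ∈ B n (c : X d), Ψ (c' : X d) q)⁻¹ ⟨b, h.1⟩ ⟨b', h.2⟩ else 0)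
          atTop (𝓝 (M b b'))) ∧
        (∀ b b' : X d, |M b b'| ≤ c₁ * exp (-(δ₁ * ∑ i, (((b i - b' i).natAbs : ℕ) : ℝ)))) ∧
        (∀ (S : Finset (X d)) (β : X d → ℝ), (∀ b, 0 ≤ β b) →
          (∀ b ∈ S, ∀ z ∉ S, β b ≤ ∑ i, (((b i - z i).natAbs : ℕ) : ℝ)) →
          ∀ b b' : S, |(Matrix.of fun b b' : S => (((n : ℝ) + 1) ^ d)⁻¹ * ∑ q ∈ B n (b : X d), Ψ (b' : X d) q)⁻¹ b b' - M b b'|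
            ≤ c₁ * exp (-(δ₁ * (∑ i, ((((b : X d) i - (b' : X d) i).natAbs : ℕ) : ℝ) + β b + β b')))) := by
  obtain ⟨c₁, δ₁, hc₁, hδ₁, H4⟩ := zd_coarse_section_inverse (d := d) hd a ha hlam hLam
  refine ⟨c₁, δ₁, hc₁, hδ₁, fun n V hV hV' Ψ BΨ hΨB hΨ => ?_⟩
  exact limit_of_sections (d := d) hc₁ hδ₁
    (fun S => (Matrix.of fun b b' : S => (((n : ℝ) + 1) ^ d)⁻¹ * ∑ q ∈ B n (b : X d), Ψ (b' : X d) q)⁻¹)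
    (fun S b b' => (H4 n V hV hV' Ψ BΨ hΨB hΨ S S (Finset.Subset.refl S)).1 b b')
    (fun S S' hSS' β hβ0 hβ b b' => (H4 n V hV hV' Ψ BΨ hΨB hΨ S S' hSS').2 β hβ0 hβ b b')

/-! ## §6. Toy -/

/-- Toy (`d = 3`): the origin of `ℤ³` lies in every cube `[−R, R]³`. -/
example (R : ℕ) : (0 : X 3) ∈ Fintype.piFinset fun _ : Fin 3 => Finset.Icc (-(R : ℤ)) R :=
  mem_cube_of_l1_le (d := 3) R 0 (by simp)

end Summit.QuantumFields.BalabanUV.T4Continuum.NE7b.SupZdCoarseInverse
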